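import Summits.Ventures.LatticeQCDFlow.Scaling.ReplicaExchangeModeTorpid
import Summits.Ventures.LatticeQCDFlow.Scaling.SimulatedTemperingModeTorpid
import Summits.Ventures.LatticeQCDFlow.Scaling.SimulatedTemperingCommonMode

/-!
HONEST FRAMING: exact (Metropolis-corrected) sampling algorithms for lattice gauge theory; figures
of merit are autocorrelation/cost numbers at stated couplings and volumes; no continuum-physics
claim.

# ExchangeSchemeCommonModeCeiling — NO EXCHANGE OR LEVEL SCHEME RELAXES AN OBSERVABLE FASTER THAN THE REPLICAS' OWN
# UPDATES DO, SUMMED OVER THE LADDER: FOR `P = t·Q + (1−t)·Upd_w` WITH `Q` ANY `π̃`-REVERSIBLE MOVE PRESERVING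
# `Σ_k h(x_k)` (EVERY PERMUTATION OF THE REPLICAS — ANY PAIRS, ANY TOPOLOGY, ANY SCHEDULE — AND ANY `h`-PRESERVING
# MAPS), `Gap(P) ≤ (1−t)·Σ_k w_k 𝓔_{μ_k}(M_k;h)/Σ_k Var_{μ_k}(h)`, `ε`-SLOW AT EVERY LEVEL ⇒ `Gap ≤ (1−t)·ε·max_k w_k`;
# AND FOR SIMULATED TEMPERING `P = t·Q + (1−t)·W` WITH ANY `π`-REVERSIBLE `h`-PRESERVING LEVEL MOVE,
# `Gap(P) ≤ (1−t)·Σ_k 𝓔_{μ_k}(M_k;h)/Σ_k Var_{μ_k}(h) ≤ (1−t)·ε` (lean-2 GEN-20, ours)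

Venture-side (OURS).  Cell `lqcd-flow` (pub-lqcd), unit `pub-lqcd-lean-2-g20`, 2026-08-25.  Chapter H (universal
ceilings).  `ReplicaExchangeCommonMode` proved this for the Metropolis ladder with uniform weights; here the exchange
move is ARBITRARY (as `ExchangeSchemeSectorCeiling` generalised `ReplicaExchangeModeTorpid` from indicators of sectors
to every count-preserving move, this file generalises the common-mode ceiling from adjacent swaps to every move that
preserves the level sum of the observable).  State space `Fin (K+1) → S` (`S` finite), law `π̃ = ⊗_k μ_k`
(`tensorFun μ`), `Upd_w = prodKernel w M` (weights `w`, `M_k` row-stochastic `μ_k`-reversible),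
`P = t·Q + (1−t)·Upd_w`; an observable `h : S → ℝ` of one configuration, its LEVEL-CENTRED SUM
`F_h(x) = Σ_k (h(x_k) − E_{μ_k} h)`; the exchange move satisfies `Q(x,y) ≠ 0 ⇒ Σ_k h(y_k) = Σ_k h(x_k)` — automatic for
every `h` when `y` is a permutation of `x` (`levelSum_comp_perm`).

## What is proved (finite-chain vocabulary of `Literature.Probability.MarkovChains`)

* §1 `levelSum_comp_perm`; `tensorFun_mean_levelCentredSum` (`E_π̃ F_h = 0`), `tensorFun_piInner_levelCentredSum`
  (`‖F_h‖² = Σ_k Var_{μ_k}(h)`), `prodKernel_dirichletForm_levelCentredSum` (`𝓔_{Upd_w}(F_h) = Σ_k w_k𝓔_{μ_k}(M_k;h)`),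
  `exchange_dirichletForm_levelCentredSum` (`𝓔_Q(F_h) = 0`), `exchangeScheme_dirichletForm_levelCentredSum`.
* §2 **`commonMode_spectralGap_le`** — `Gap(P) ≤ (1−t)·Σ_k w_k𝓔_{μ_k}(M_k;h)/Σ_k Var_{μ_k}(h)` (`0 ≤ t ≤ 1`, `w` a
  probability vector, `|S| ≥ 2`, `Σ_k Var_k(h) > 0`; Levin–Peres–Wilmer Lemma 13.7, PROVED in the tree);
  **`commonMode_spectralGap_le_of_slow`** — `𝓔_{μ_k}(M_k;h) ≤ ε·Var_{μ_k}(h)` and `w_k ≤ W` for all `k` ⇒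
  `Gap(P) ≤ (1−t)·ε·W`; **`commonMode_tauInt_ge`** — irreducible `P` ⇒
  `τ_int(F_h) ≥ Σ_k Var_k(h)/((1−t)Σ_k w_k𝓔_k(h)) − ½`.
* §3 SIMULATED TEMPERING (setting of `SimulatedTemperingFiniteSampler`, `W = stFinWithin M`, observable `h∘snd`, ANY
  row-stochastic `π`-reversible level move `Q` with `Q(p,q) ≠ 0 ⇒ h(q.2) = h(p.2)` — every configuration-keeping move,
  and map-moves preserving `h`): `stFinWithin_dirichletForm_comp_snd` (`𝓔_W(h∘snd) = Σ_k𝓔_k(h)/(K+1)`),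
  `levelMove_dirichletForm_comp_snd` (`= 0`), **`levelCommonMode_spectralGap_le`** —
  `Gap(t·Q + (1−t)·W) ≤ (1−t)·Σ_k𝓔_{μ_k}(M_k;h)/Σ_k Var_{μ_k}(h)`; **`levelCommonMode_spectralGap_le_of_slow`** — `≤ (1−t)ε`
  (generalising `SimulatedTemperingCommonMode` from the Metropolis level move to every level move).

Reading (no numerics implied): whatever is learned about exchanging replicas — which pairs, in what order, with what
acceptance rule, through which configuration-preserving relabelling — an observable that is slow under every replica's
own update (a topological charge frozen at every coupling of the window) is slow under the whole scheme, with the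
weights `w_k` saying only how often each replica is touched.  Maps between couplings escape this file exactly when they
change `Σ_k h(x_k)`, i.e. when they move the observable themselves.  NOT CLAIMED: the positive direction; general
configuration spaces; non-reversible schedules (the mixing-time version would follow `SectorCountMixingFloor`); anything
measured.  Literature grade (cell rule): KNOWN MECHANISM (test-function gap ceilings; "tempering cannot remove a
bottleneck present at all temperatures", Woodard–Schmidler–Huber 2009, Bhatnagar–Randall 2004), NEW TYPING (arbitrary
exchange move and weights); nothing cited as a fact; no new bib keys.
-/

noncomputable section

open Finset Function
open Literature.Probability.MarkovChains

namespace Summit.Ventures.LatticeQCDFlow.Scaling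

variable {S : Type*} [Fintype S] [DecidableEq S] {K : ℕ} {μ : Fin (K + 1) → S → ℝ}
  {M : Fin (K + 1) → S → S → ℝ} {w : Fin (K + 1) → ℝ} {t : ℝ}
  {Q : Matrix (Fin (K + 1) → S) (Fin (K + 1) → S) ℝ}

/-! ## §1 The level-centred sum of an observable -/

omit [Fintype S] [DecidableEq S] in
/-- **A permutation of the replicas keeps every level sum:** `Σ_k h(x_{σ k}) = Σ_k h(x_k)`. [ours] -/
theorem levelSum_comp_perm (h : S → ℝ) (σ : Equiv.Perm (Fin (K + 1))) (x : Fin (K + 1) → S) :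
    ∑ k, h ((x ∘ σ) k) = ∑ k, h (x k) :=
  Equiv.sum_comp σ (fun k => h (x k))

omit [DecidableEq S] in
/-- **`E_π̃ F_h = 0`.** [ours] -/
theorem tensorFun_mean_levelCentredSum (hμ1 : ∀ k, ∑ u, μ k u = 1) (h : S → ℝ) :
    ∑ x : Fin (K + 1) → S, tensorFun μ x * ∑ k, (h (x k) - lawMean (μ k) h) = 0 := by
  rw [sum_tensorFun_mul_additive μ hμ1 (fun k u => h u - lawMean (μ k) h)]
  exact sum_eq_zero fun k _ => sum_mul_sub_lawMean (hμ1 k) h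

omit [DecidableEq S] in
/-- **`‖F_h‖²_π̃ = Σ_k Var_{μ_k}(h)`** (independent levels). [ours] -/
theorem tensorFun_piInner_levelCentredSum (hμ1 : ∀ k, ∑ u, μ k u = 1) (h : S → ℝ) :
    piInner (tensorFun μ) (fun x => ∑ k, (h (x k) - lawMean (μ k) h)) (fun x => ∑ k, (h (x k) - lawMean (μ k) h))
      = ∑ k, lawVariance (μ k) h := by
  rw [piInner_tensorFun_additive μ hμ1 (fun k u => h u - lawMean (μ k) h) (fun k => sum_mul_sub_lawMean (hμ1 k) h)]
  exact sum_congr rfl fun k _ => piInner_centred_eq_lawVariance (μ k) h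

/-- **`𝓔_{Upd_w}(F_h) = Σ_k w_k·𝓔_{μ_k}(M_k; h)`** (one replica moves at a time; constants do not matter). [ours] -/
theorem prodKernel_dirichletForm_levelCentredSum (hμ1 : ∀ k, ∑ u, μ k u = 1) (w : Fin (K + 1) → ℝ)
    (M : Fin (K + 1) → S → S → ℝ) (h : S → ℝ) :
    dirichletForm (tensorFun μ) (prodKernel w M) (fun x => ∑ k, (h (x k) - lawMean (μ k) h))
      = ∑ k, w k * dirichletForm (μ k) (M k) h := by
  rw [dirichletForm_prodKernel_additive μ hμ1 w M (fun k u => h u - lawMean (μ k) h)]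
  exact sum_congr rfl fun k _ => by rw [dirichletForm_sub_const]

omit [DecidableEq S] in
/-- **A move preserving `Σ_k h(x_k)` is invisible to `F_h`:** `𝓔_Q(F_h) = 0`. [ours] -/
theorem exchange_dirichletForm_levelCentredSum (h : S → ℝ)
    (hQh : ∀ x y, Q x y ≠ 0 → ∑ k, h (y k) = ∑ k, h (x k)) :
    dirichletForm (tensorFun μ) Q (fun x => ∑ k, (h (x k) - lawMean (μ k) h)) = 0 := by
  unfold dirichletForm
  rw [sum_eq_zero fun x _ => sum_eq_zero fun y _ => ?_, mul_zero]
  by_cases hxy : Q x y = 0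
  · rw [hxy, mul_zero, zero_mul]
  · have e : (∑ k, (h (x k) - lawMean (μ k) h)) - ∑ k, (h (y k) - lawMean (μ k) h) = 0 := by
      rw [sum_sub_distrib, sum_sub_distrib, hQh x y hxy]; ring
    rw [e]; ring

omit [DecidableEq S] in
/-- **`𝓔_P(F_h) = (1−t)·Σ_k w_k𝓔_{μ_k}(M_k;h)`** for `P = t·Q + (1−t)·Upd_w`. [ours] -/
theorem exchangeScheme_dirichletForm_levelCentredSum [DecidableEq S] (hμ1 : ∀ k, ∑ u, μ k u = 1) (t : ℝ) (h : S → ℝ)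
    (hQh : ∀ x y, Q x y ≠ 0 → ∑ k, h (y k) = ∑ k, h (x k)) :
    dirichletForm (tensorFun μ) (fun x y : Fin (K + 1) → S => t * Q x y + (1 - t) * prodKernel w M x y)
        (fun x => ∑ k, (h (x k) - lawMean (μ k) h))
      = (1 - t) * ∑ k, w k * dirichletForm (μ k) (M k) h := by
  have hsplit : ∀ F : (Fin (K + 1) → S) → ℝ,
      dirichletForm (tensorFun μ) (fun x y : Fin (K + 1) → S => t * Q x y + (1 - t) * prodKernel w M x y) F
        = t * dirichletForm (tensorFun μ) Q F + (1 - t) * dirichletForm (tensorFun μ) (prodKernel w M) F := by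
    intro F
    unfold dirichletForm
    rw [← mul_assoc, ← mul_assoc, mul_comm t, mul_comm (1 - t), mul_assoc, mul_assoc, ← mul_add]
    congr 1
    rw [mul_sum, mul_sum, ← sum_add_distrib]
    refine sum_congr rfl fun x _ => ?_
    rw [mul_sum, mul_sum, ← sum_add_distrib]
    exact sum_congr rfl fun y _ => by ring
  rw [hsplit, exchange_dirichletForm_levelCentredSum h hQh, prodKernel_dirichletForm_levelCentredSum hμ1, mul_zero,
    zero_add]

/-! ## §2 The common-mode ceiling for every exchange scheme -/

section Scheme

variable (hμ : ∀ k x, 0 < μ k x) (hμ1 : ∀ k, ∑ u, μ k u = 1) (hM : ∀ k, IsRowStochastic (M k))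
  (hMrev : ∀ k, DetailedBalance (μ k) (M k)) (hw0 : ∀ k, 0 ≤ w k) (hw1 : ∑ k, w k = 1) (ht0 : 0 ≤ t) (ht1 : t ≤ 1)
  (hQ : IsRowStochastic Q) (hQrev : DetailedBalance (tensorFun μ) Q) (h : S → ℝ)
  (hQh : ∀ x y, Q x y ≠ 0 → ∑ k, h (y k) = ∑ k, h (x k)) (hV : 0 < ∑ k, lawVariance (μ k) h)
include hμ hμ1 hM hMrev hw0 hw1 ht0 ht1 hQ hQrev hQh hV

/-- **NO EXCHANGE SCHEME BEATS A COMMON SLOW MODE:**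
`Gap(t·Q + (1−t)·Upd_w) ≤ (1−t)·Σ_k w_k𝓔_{μ_k}(M_k;h)/Σ_k Var_{μ_k}(h)`. [ours] -/
theorem commonMode_spectralGap_le [Nontrivial S] :
    spectralGap (tensorFun μ) (fun x y : Fin (K + 1) → S => t * Q x y + (1 - t) * prodKernel w M x y)
      ≤ (1 - t) * (∑ k, w k * dirichletForm (μ k) (M k) h) / ∑ k, lawVariance (μ k) h := by
  have hU := prodKernel_isRowStochastic M w hw0 hw1 hM
  have hUrev := prodKernel_detailedBalance hMrev w
  have hP : IsRowStochastic (fun x y : Fin (K + 1) → S => t * Q x y + (1 - t) * prodKernel w M x y) := by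
    refine ⟨fun x y => add_nonneg (mul_nonneg ht0 (hQ.1 x y)) (mul_nonneg (by linarith) (hU.1 x y)), fun x => ?_⟩
    simp only
    rw [sum_add_distrib, ← mul_sum, ← mul_sum, hQ.2 x, hU.2 x]; ring
  have hDB : DetailedBalance (tensorFun μ) (fun x y : Fin (K + 1) → S => t * Q x y + (1 - t) * prodKernel w M x y) := by
    intro x y
    have h1 := hQrev x y
    have h2 := hUrev x y
    linear_combination t * h1 + (1 - t) * h2
  have hray := LevinPeres2017_lemma_13_7_rayleigh (tensorFun_pos hμ) (sum_tensorFun_eq_one μ hμ1) hP hDB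
    (tensorFun_mean_levelCentredSum (μ := μ) hμ1 h)
  rw [tensorFun_piInner_levelCentredSum hμ1, exchangeScheme_dirichletForm_levelCentredSum hμ1 t h hQh] at hray
  rw [le_div_iff₀ hV]
  exact hray

/-- **`ε`-SLOW AT EVERY LEVEL ⇒ `Gap ≤ (1−t)·ε·W`** (`W` an upper bound of the weights; uniform weights:
`W = 1/(K+1)`). [ours] -/
theorem commonMode_spectralGap_le_of_slow [Nontrivial S] {ε W : ℝ} (hslow : ∀ k, dirichletForm (μ k) (M k) h ≤ ε * lawVariance (μ k) h)
    (hW : ∀ k, w k ≤ W) (hε : 0 ≤ ε) :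
    spectralGap (tensorFun μ) (fun x y : Fin (K + 1) → S => t * Q x y + (1 - t) * prodKernel w M x y)
      ≤ (1 - t) * ε * W := by
  refine (commonMode_spectralGap_le hμ hμ1 hM hMrev hw0 hw1 ht0 ht1 hQ hQrev h hQh hV).trans ?_
  have hVk : ∀ k, 0 ≤ lawVariance (μ k) h := fun k =>
    sum_nonneg fun u _ => mul_nonneg (hμ k u).le (sq_nonneg _)
  have hSE : ∑ k, w k * dirichletForm (μ k) (M k) h ≤ ε * W * ∑ k, lawVariance (μ k) h := by
    rw [mul_sum]
    refine sum_le_sum fun k _ => ?_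
    calc w k * dirichletForm (μ k) (M k) h ≤ w k * (ε * lawVariance (μ k) h) :=
          mul_le_mul_of_nonneg_left (hslow k) (hw0 k)
      _ ≤ W * (ε * lawVariance (μ k) h) := mul_le_mul_of_nonneg_right (hW k) (mul_nonneg hε (hVk k))
      _ = ε * W * lawVariance (μ k) h := by ring
  rw [div_le_iff₀ hV]
  have h1t : 0 ≤ 1 - t := by linarith
  calc (1 - t) * ∑ k, w k * dirichletForm (μ k) (M k) h ≤ (1 - t) * (ε * W * ∑ k, lawVariance (μ k) h) :=
        mul_le_mul_of_nonneg_left hSE h1t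
    _ = (1 - t) * ε * W * ∑ k, lawVariance (μ k) h := by ring

/-- **THE LEVEL-CENTRED SUM STAYS CORRELATED:** irreducible `P` ⇒
`τ_int(F_h) = asympVar/(2Var) ≥ Σ_k Var_{μ_k}(h)/((1−t)·Σ_k w_k𝓔_{μ_k}(M_k;h)) − ½`. [ours] -/
theorem commonMode_tauInt_ge
    (hirr : IsIrreducible (fun x y : Fin (K + 1) → S => t * Q x y + (1 - t) * prodKernel w M x y)) :
    (∑ k, lawVariance (μ k) h) / ((1 - t) * ∑ k, w k * dirichletForm (μ k) (M k) h) - 1 / 2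
      ≤ asympVar (fun x => ∑ k, (h (x k) - lawMean (μ k) h)) (tensorFun μ)
            (fun x y : Fin (K + 1) → S => t * Q x y + (1 - t) * prodKernel w M x y)
          / (2 * lawVariance (tensorFun μ) (fun x : Fin (K + 1) → S => ∑ k, (h (x k) - lawMean (μ k) h))) := by
  have hU := prodKernel_isRowStochastic M w hw0 hw1 hM
  have hUrev := prodKernel_detailedBalance hMrev w
  have hP : IsRowStochastic (fun x y : Fin (K + 1) → S => t * Q x y + (1 - t) * prodKernel w M x y) := by
    refine ⟨fun x y => add_nonneg (mul_nonneg ht0 (hQ.1 x y)) (mul_nonneg (by linarith) (hU.1 x y)), fun x => ?_⟩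
    simp only
    rw [sum_add_distrib, ← mul_sum, ← mul_sum, hQ.2 x, hU.2 x]; ring
  have hDB : DetailedBalance (tensorFun μ) (fun x y : Fin (K + 1) → S => t * Q x y + (1 - t) * prodKernel w M x y) := by
    intro x y
    have h1 := hQrev x y
    have h2 := hUrev x y
    linear_combination t * h1 + (1 - t) * h2
  set F : (Fin (K + 1) → S) → ℝ := fun x => ∑ k, (h (x k) - lawMean (μ k) h) with hF
  have hπ1 := sum_tensorFun_eq_one μ hμ1
  -- `F` is centred, so its variance is its norm
  have hmean : lawMean (tensorFun μ) F = 0 := tensorFun_mean_levelCentredSum (μ := μ) hμ1 h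
  have hVarF : lawVariance (tensorFun μ) F = ∑ k, lawVariance (μ k) h := by
    rw [← tensorFun_piInner_levelCentredSum hμ1 h, ← hF]
    unfold lawVariance piInner
    exact sum_congr rfl fun x _ => by rw [hmean, sub_zero]; ring
  have hVpos : 0 < lawVariance (tensorFun μ) F := by rw [hVarF]; exact hV
  have key := tauInt_ge_var_div_dirichletForm (tensorFun_pos hμ) hπ1 hP hDB hirr hVpos
  rw [hVarF, hF, exchangeScheme_dirichletForm_levelCentredSum hμ1 t h hQh] at key
  rw [hVarF]
  exact key

end Scheme

/-! ## §3 The same for every level scheme of simulated tempering -/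

section Level

variable {M' : Fin (K + 1) → Matrix S S ℝ} {L : Matrix (Fin (K + 1) × S) (Fin (K + 1) × S) ℝ}

omit [DecidableEq S] in
/-- **`𝓔_W(h∘snd) = Σ_k 𝓔_{μ_k}(M_k;h)/(K+1)`** for the within-level update `W = stFinWithin M`. [ours] -/
theorem stFinWithin_dirichletForm_comp_snd (M' : Fin (K + 1) → Matrix S S ℝ) (h : S → ℝ) :
    dirichletForm (stFinLaw μ) (stFinWithin M') (fun p => h p.2) = 1 / (K + 1) * ∑ k, dirichletForm (μ k) (M' k) h := by
  have inner : ∀ (k : Fin (K + 1)) (x : S),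
      ∑ q : Fin (K + 1) × S, stFinLaw μ (k, x) * stFinWithin M' (k, x) q * (h x - h q.2) ^ 2
        = 1 / (K + 1) * ∑ y, μ k x * M' k x y * (h x - h y) ^ 2 := by
    intro k x
    rw [Fintype.sum_prod_type]
    have e : ∀ (l : Fin (K + 1)) (y : S),
        stFinLaw μ (k, x) * stFinWithin M' (k, x) (l, y) * (h x - h ((l, y) : Fin (K + 1) × S).2) ^ 2
          = if l = k then 1 / (K + 1) * (μ k x * M' k x y * (h x - h y) ^ 2) else 0 := by
      intro l y
      simp only [stFinWithin_apply]
      unfold stFinLaw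
      split_ifs <;> ring
    simp_rw [e]
    rw [sum_ite_eq_level k (fun _ y => 1 / (K + 1) * (μ k x * M' k x y * (h x - h y) ^ 2)), ← mul_sum]
  unfold dirichletForm
  rw [Fintype.sum_prod_type]
  simp only []
  simp_rw [inner]
  simp_rw [← mul_sum]
  ring

omit [DecidableEq S] in
/-- **A level move preserving `h` is invisible to `h∘snd`:** `𝓔_Q(h∘snd) = 0`. [ours] -/
theorem levelMove_dirichletForm_comp_snd (h : S → ℝ) (hLh : ∀ p q, L p q ≠ 0 → h q.2 = h p.2) :
    dirichletForm (stFinLaw μ) L (fun p => h p.2) = 0 := by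
  unfold dirichletForm
  rw [sum_eq_zero fun p _ => sum_eq_zero fun q _ => ?_, mul_zero]
  by_cases hpq : L p q = 0
  · rw [hpq, mul_zero, zero_mul]
  · simp only [hLh p q hpq, sub_self]; ring

variable (hμ : ∀ k x, 0 < μ k x) (hμ1 : ∀ k, ∑ u, μ k u = 1) (hM : ∀ k, IsRowStochastic (M' k))
  (hMrev : ∀ k, DetailedBalance (μ k) (M' k)) (ht0 : 0 ≤ t) (ht1 : t ≤ 1) (hL : IsRowStochastic L)
  (hLrev : DetailedBalance (stFinLaw μ) L) (h : S → ℝ) (hLh : ∀ p q, L p q ≠ 0 → h q.2 = h p.2)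
  (hV : 0 < ∑ k, lawVariance (μ k) h)
include hμ hμ1 hM hMrev ht0 ht1 hL hLrev hLh hV

omit [DecidableEq S] in
/-- **NO LEVEL SCHEME BEATS A COMMON SLOW MODE:** `Gap(t·Q + (1−t)·W) ≤ (1−t)·Σ_k𝓔_{μ_k}(M_k;h)/Σ_k Var_{μ_k}(h)` for every
row-stochastic `π`-reversible `h`-preserving level move `Q` (`|S| ≥ 2`). [ours] -/
theorem levelCommonMode_spectralGap_le [Nontrivial S] :
    spectralGap (stFinLaw μ) (fun p q : Fin (K + 1) × S => t * L p q + (1 - t) * stFinWithin M' p q)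
      ≤ (1 - t) * (∑ k, dirichletForm (μ k) (M' k) h) / ∑ k, lawVariance (μ k) h := by
  have hW := stFinWithin_isRowStochastic (K := K) hM
  have hWrev := stFinWithin_detailedBalance (μ := μ) hMrev
  have hP : IsRowStochastic (fun p q : Fin (K + 1) × S => t * L p q + (1 - t) * stFinWithin M' p q) := by
    refine ⟨fun p q => add_nonneg (mul_nonneg ht0 (hL.1 p q)) (mul_nonneg (by linarith) (hW.1 p q)), fun p => ?_⟩
    simp only
    rw [sum_add_distrib, ← mul_sum, ← mul_sum, hL.2 p, hW.2 p]; ring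
  have hDB : DetailedBalance (stFinLaw μ) (fun p q : Fin (K + 1) × S => t * L p q + (1 - t) * stFinWithin M' p q) := by
    intro p q
    have h1 := hLrev p q
    have h2 := hWrev p q
    linear_combination t * h1 + (1 - t) * h2
  have hπ1 := sum_stFinLaw (K := K) hμ1
  have hK : (0 : ℝ) < K + 1 := by positivity
  have hVar := stFin_lawVariance_comp_snd_ge (μ := μ) hμ hμ1 h
  have hVpos : 0 < lawVariance (stFinLaw μ) (fun p : Fin (K + 1) × S => h p.2) :=
    lt_of_lt_of_le (mul_pos (by positivity) hV) hVar
  have hE : dirichletForm (stFinLaw μ) (fun p q : Fin (K + 1) × S => t * L p q + (1 - t) * stFinWithin M' p q)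
      (fun p => h p.2) = (1 - t) * (1 / (K + 1) * ∑ k, dirichletForm (μ k) (M' k) h) := by
    have hsplit : dirichletForm (stFinLaw μ) (fun p q : Fin (K + 1) × S => t * L p q + (1 - t) * stFinWithin M' p q)
        (fun p => h p.2) = t * dirichletForm (stFinLaw μ) L (fun p => h p.2)
          + (1 - t) * dirichletForm (stFinLaw μ) (stFinWithin M') (fun p => h p.2) := by
      unfold dirichletForm
      rw [← mul_assoc, ← mul_assoc, mul_comm t, mul_comm (1 - t), mul_assoc, mul_assoc, ← mul_add]
      congr 1
      rw [mul_sum, mul_sum, ← sum_add_distrib]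
      refine sum_congr rfl fun p _ => ?_
      rw [mul_sum, mul_sum, ← sum_add_distrib]
      exact sum_congr rfl fun q _ => by ring
    rw [hsplit, levelMove_dirichletForm_comp_snd h hLh, stFinWithin_dirichletForm_comp_snd, mul_zero, zero_add]
  rw [LevinPeres2017_lemma_13_7 (stFinLaw_pos hμ) hπ1 hP hDB]
  refine (spectralGapR_le_dirichletForm_div_lawVariance (fun p => (stFinLaw_pos hμ p).le) hπ1 hP.1 hVpos).trans ?_
  rw [hE, div_le_div_iff₀ hVpos hV]
  have hEk : 0 ≤ ∑ k, dirichletForm (μ k) (M' k) h :=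
    sum_nonneg fun k _ => dirichletForm_nonneg (fun u => (hμ k u).le) (hM k).1 _
  have h1t : 0 ≤ 1 - t := by linarith
  calc (1 - t) * (1 / (K + 1) * ∑ k, dirichletForm (μ k) (M' k) h) * ∑ k, lawVariance (μ k) h
      = (1 - t) * (∑ k, dirichletForm (μ k) (M' k) h) * (1 / (K + 1) * ∑ k, lawVariance (μ k) h) := by ring
    _ ≤ (1 - t) * (∑ k, dirichletForm (μ k) (M' k) h) * lawVariance (stFinLaw μ) (fun p : Fin (K + 1) × S => h p.2) :=
        mul_le_mul_of_nonneg_left hVar (mul_nonneg h1t hEk)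

omit [DecidableEq S] in
/-- **`ε`-SLOW AT EVERY LEVEL ⇒ `Gap ≤ (1−t)ε`** for every such level scheme. [ours] -/
theorem levelCommonMode_spectralGap_le_of_slow [Nontrivial S] {ε : ℝ}
    (hslow : ∀ k, dirichletForm (μ k) (M' k) h ≤ ε * lawVariance (μ k) h) :
    spectralGap (stFinLaw μ) (fun p q : Fin (K + 1) × S => t * L p q + (1 - t) * stFinWithin M' p q) ≤ (1 - t) * ε := by
  refine (levelCommonMode_spectralGap_le hμ hμ1 hM hMrev ht0 ht1 hL hLrev h hLh hV).trans ?_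
  rw [div_le_iff₀ hV, mul_sum, mul_sum]
  refine sum_le_sum fun k _ => ?_
  rw [mul_assoc]
  exact mul_le_mul_of_nonneg_left (hslow k) (by linarith)

end Level

end Summit.Ventures.LatticeQCDFlow.Scaling

end
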